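import Summits.ValiantsHypothesis.ValiantsHypothesis.Theses.GaugeDescent
import Literature.Computability.AlgebraicComplexity.SharpPBitsPPolyModP

/-!
# GaugeDescent, support item `ModPCollapse` (stmt-ValiantsHypothesis-6638) — PROVED

Route `GaugeDescent` of `ValiantsHypothesis`, support item `ModPCollapse`: the GLUE
`PrimeFieldTransfer → (VP_ℂ = VNP_ℂ → NP ⊆ P/poly)`.

Proof (the item's own recipe, Bürgisser 2000 TCS §5 (A3) / TR06-113 Lemma 2.12 with advice primes):
`PrimeFieldTransfer` applied to `VP_ℂ = VNP_ℂ` and the p-bounded `ℓ = id` gives p-bounded `r`, `s`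
and, for every `N`, a prime `p` with `2^N < p ≤ 2^{r(N)}` and `L_{ℤ/p}(per_N) ≤ s(N)` (constants of
`ℤ/p` allowed — they are advice); the Literature theorem
`NP_subset_PPoly_of_isPBounded_modP_perPoly` (`SharpPBitsPPolyModP.lean`: for `f ∈ #P`,
`2^K f(x) = per_{N'}(B(x))` with `N'` padded above `K + m`, evaluate the cheap `ℤ/p`-circuit for
`per_{N'}` at `B(x)` by polynomial-size Boolean circuits, read `2^K f(x) < p` off the residue, so
`#P ⊆ FP/poly`, `P^{#P} ⊆ P/poly`, and `NP ⊆ P^{#P}`) concludes. Honest framing: Boolean bookkeeping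
on a dormant VP-program route; VP ≠ VNP is NOT proved and nothing here is progress on it.
-/

noncomputable section

-- the summit and the problem share the name `ValiantsHypothesis` (D-0017 single-conjunct layout)
set_option linter.dupNamespace false

namespace Summit.ValiantsHypothesis.ValiantsHypothesis.Theorems.GaugeDescent

open Literature.Computability.AlgebraicComplexity

/-- **`ModPCollapse` (stmt-ValiantsHypothesis-6638):** `PrimeFieldTransfer → VP_ℂ = VNP_ℂ →
NP ⊆ P/poly` — apply `PrimeFieldTransfer` with `ℓ = id` and the prime-field Boolean simulation
`NP_subset_PPoly_of_isPBounded_modP_perPoly`. -/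
theorem modPCollapse_proof :
    Summit.ValiantsHypothesis.ValiantsHypothesis.Theses.GaugeDescent.ModPCollapse := by
  intro hPFT hVPVNP
  obtain ⟨r, s, hr, hs, hprime⟩ := hPFT hVPVNP (fun n => n) IsPBounded.id
  exact NP_subset_PPoly_of_isPBounded_modP_perPoly hr hs hprime

end Summit.ValiantsHypothesis.ValiantsHypothesis.Theorems.GaugeDescent
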